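import Summits.ValiantsHypothesis.ValiantsHypothesis.Theorems.KPlusLogSqLawTridiagonalRealStaticUnitCrossingDirection

/-!
# Route «KPlusLogSqLaw», crux `WeakLifting` (stmt-ValiantsHypothesis-19561) — REAL side of the tridiagonal sector:
# the UNIT-COEFFICIENT sub-sector, ALL SIZES — KERNEL VECTOR, the HELLMANN–FEYNMAN QUADRATIC FORM, and the SMALL-SIZE crossing law

HONEST FRAMING.  Helper theorems (`--supports stmt-ValiantsHypothesis-19561 --as helper`), seat val-sym-lift-p1 (g18), cell `pub-symmetroid`,
2026-08-28; companion of `…UnitCrossingDirection` (p633123) and `…UnitEntropyBalance` (p632571).  Currency `StaticTridiagonalRealPotential.pathDet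
(fun _ => 1) d (fun _ => 1) f` (continuants `D_k(x)`), `F_k = f_0 + ⋯ + f_{k−1}`, edge slopes `L_k = 2f_k − d_k − d_{k+1}`.  Proved here, for all
sizes and all exponents:
* **KERNEL VECTOR** (`kernelVec_row_zero`, `kernelVec_row_succ`, `kernelVec_row_last`): `w_i := (−1)^i D_i(x) / x^{F_i}` satisfies the rows of
  `J(x)·w = 0` for the unit monomial matrix `J(x)` (diagonal `x^{d_i}`, links `x^{f_k}`): row `0` and every three-term row identically (the
  continuant recurrence), the last row exactly when `D_m(x) = 0`;
* **HELLMANN–FEYNMAN QUADRATIC FORM** (`mass_eq`, `link_eq`, `weighted_mass_sum`, `quadForm_eq_neg_slopeEnergy`): with energies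
  `e_k = D_kD_{k+1}x^{−2F_k} = −x^{f_k}w_kw_{k+1}` and masses `μ_i = x^{d_i}w_i²`, the quadratic form of the entrywise `x·d/dx` of `J(x)` at `w`,
  `Σ_i d_i x^{d_i} w_i² + 2Σ_k f_k x^{f_k} w_k w_{k+1}`, equals `−Σ_k L_k e_k` at a zero of `D_m` — so the sign certified by
  `slopeEnergy_pos_below_one` / `slopeEnergy_neg_above_one` is (minus) the velocity of the zero eigenvalue: on the recessive side of a one-signed
  unit design the inertia count goes UP through every zero without the `N J A N` pivot pattern;
* **SMALL SIZES** (`slopeEnergy_balance_pos_of_le_eight`): for `m ≤ 8` the separation hypothesis of the crossing-direction law is automatic at a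
  zero (two negative pivots three edges apart need the pivot word `E A N J A N J A Z`, nine letters), so the law holds for EVERY nondegenerate zero
  with recessive edges — the kernel form of «zeros in the recessive unit interval = ⌊m/3⌋ exactly for m ≤ 8» up to the Jacobi-formula step
  (memo CROSSING-DIRECTION-liftp1g18.md §4).
Nothing here is an upper law for the register (α NO MOVER); nothing bears on `WeakLifting` / `TropicalB` (stmt-19771) in their windows,
Conjecture B, the Door-A registers, `MatrixDescartes` (stmt-18050) or VP ≠ VNP.
[this seat; folklore: kernel vector of a Jacobi matrix via continuants, Hellmann–Feynman]
-/

-- `Summit.ValiantsHypothesis.ValiantsHypothesis.…` repeats a component by the D-0017 layout (single-conjunct summit); the name is mandated.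
set_option linter.dupNamespace false
set_option autoImplicit false

namespace Summit.ValiantsHypothesis.ValiantsHypothesis.Theorems.KPlusLogSqLaw
namespace StaticTridiagonalRealUnit

open Real Finset Polynomial
open Summit.ValiantsHypothesis.ValiantsHypothesis.Theorems.KPlusLogSqLaw.StaticTridiagonalRealPotential (pathDet)

variable (d : ℕ → ℕ) (f : ℕ → ℕ)

/-! ### 1. The kernel vector `w_i = (−1)^i D_i(x) / x^{F_i}` -/

/-- **row `0`**: `x^{d_0} w_0 + x^{f_0} w_1 = 0`. [this file] -/
theorem kernelVec_row_zero (x : ℝ) (hx : 0 < x) :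
    x ^ d 0 * ((-1) ^ 0 * (pathDet (fun _ => (1 : ℝ)) d (fun _ => (1 : ℝ)) f 0).eval x / x ^ (∑ j ∈ range 0, f j)) +
      x ^ f 0 * ((-1) ^ 1 * (pathDet (fun _ => (1 : ℝ)) d (fun _ => (1 : ℝ)) f 1).eval x / x ^ (∑ j ∈ range 1, f j)) = 0 := by
  obtain ⟨e0, e1⟩ := eval_unit_zero_one d f x
  rw [e0, e1, sum_range_one, sum_range_zero]
  have : x ^ f 0 ≠ 0 := pow_ne_zero _ hx.ne'
  field_simp
  ring

/-- **three-term rows**: `x^{f_i} w_i + x^{d_{i+1}} w_{i+1} + x^{f_{i+1}} w_{i+2} = 0` for every `i` — the recurrence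
`D_{i+2} = x^{d_{i+1}}D_{i+1} − x^{2f_i}D_i` divided by `x^{F_{i+2}}`. [this file] -/
theorem kernelVec_row_succ (x : ℝ) (hx : 0 < x) (i : ℕ) :
    x ^ f i * ((-1) ^ i * (pathDet (fun _ => (1 : ℝ)) d (fun _ => (1 : ℝ)) f i).eval x / x ^ (∑ j ∈ range i, f j)) +
      x ^ d (i + 1) * ((-1) ^ (i + 1) * (pathDet (fun _ => (1 : ℝ)) d (fun _ => (1 : ℝ)) f (i + 1)).eval x / x ^ (∑ j ∈ range (i + 1), f j)) +
      x ^ f (i + 1) * ((-1) ^ (i + 2) * (pathDet (fun _ => (1 : ℝ)) d (fun _ => (1 : ℝ)) f (i + 2)).eval x / x ^ (∑ j ∈ range (i + 2), f j)) =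
      0 := by
  rw [eval_unit_add_two d f x i, sum_range_succ, sum_range_succ, sum_range_succ, pow_add, pow_add, pow_add, pow_succ, pow_succ]
  have h1 : x ^ (∑ j ∈ range i, f j) ≠ 0 := pow_ne_zero _ hx.ne'
  have h2 : x ^ f i ≠ 0 := pow_ne_zero _ hx.ne'
  have h3 : x ^ f (i + 1) ≠ 0 := pow_ne_zero _ hx.ne'
  field_simp
  ring

/-- **last row**: `x^{f_{m−2}} w_{m−2} + x^{d_{m−1}} w_{m−1} = (−1)^{m+1} D_m(x) / x^{F_{m−1}}` (written with `m = n + 2`); in particular it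
vanishes exactly at the zeros of `D_m`, where `w` is a kernel vector of the monomial matrix. [this file] -/
theorem kernelVec_row_last (x : ℝ) (hx : 0 < x) (n : ℕ) :
    x ^ f n * ((-1) ^ n * (pathDet (fun _ => (1 : ℝ)) d (fun _ => (1 : ℝ)) f n).eval x / x ^ (∑ j ∈ range n, f j)) +
      x ^ d (n + 1) * ((-1) ^ (n + 1) * (pathDet (fun _ => (1 : ℝ)) d (fun _ => (1 : ℝ)) f (n + 1)).eval x / x ^ (∑ j ∈ range (n + 1), f j)) =
      (-1) ^ (n + 1) * (pathDet (fun _ => (1 : ℝ)) d (fun _ => (1 : ℝ)) f (n + 2)).eval x / x ^ (∑ j ∈ range (n + 1), f j) := by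
  rw [eval_unit_add_two d f x n, sum_range_succ, pow_add, pow_succ]
  have h1 : x ^ (∑ j ∈ range n, f j) ≠ 0 := pow_ne_zero _ hx.ne'
  have h2 : x ^ f n ≠ 0 := pow_ne_zero _ hx.ne'
  field_simp
  ring

/-! ### 2. The Hellmann–Feynman quadratic form -/

/-- mass: `x^{d_i} w_i² = x^{d_i} D_i² / x^{2F_i}`. [this file] -/
theorem mass_eq (x : ℝ) (i : ℕ) :
    x ^ d i * ((-1) ^ i * (pathDet (fun _ => (1 : ℝ)) d (fun _ => (1 : ℝ)) f i).eval x / x ^ (∑ j ∈ range i, f j)) ^ 2 =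
      x ^ d i * (pathDet (fun _ => (1 : ℝ)) d (fun _ => (1 : ℝ)) f i).eval x ^ 2 / x ^ (2 * ∑ j ∈ range i, f j) := by
  have h3 : ((-1 : ℝ) ^ i) ^ 2 = 1 := by rw [← pow_mul]; exact Even.neg_one_pow ⟨i, by ring⟩
  have hx' : x ^ (2 * ∑ j ∈ range i, f j) = (x ^ (∑ j ∈ range i, f j)) ^ 2 := by rw [← pow_mul, mul_comm]
  rw [hx', div_pow, mul_pow, h3, one_mul, mul_div_assoc]

/-- link: `x^{f_k} w_k w_{k+1} = −D_kD_{k+1} / x^{2F_k}` (minus the energy). [this file] -/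
theorem link_eq (x : ℝ) (hx : 0 < x) (k : ℕ) :
    x ^ f k * ((-1) ^ k * (pathDet (fun _ => (1 : ℝ)) d (fun _ => (1 : ℝ)) f k).eval x / x ^ (∑ j ∈ range k, f j)) *
        ((-1) ^ (k + 1) * (pathDet (fun _ => (1 : ℝ)) d (fun _ => (1 : ℝ)) f (k + 1)).eval x / x ^ (∑ j ∈ range (k + 1), f j)) =
      -((pathDet (fun _ => (1 : ℝ)) d (fun _ => (1 : ℝ)) f k).eval x * (pathDet (fun _ => (1 : ℝ)) d (fun _ => (1 : ℝ)) f (k + 1)).eval x /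
        x ^ (2 * ∑ j ∈ range k, f j)) := by
  rw [sum_range_succ, pow_add, pow_succ, two_mul, pow_add]
  have h1 : x ^ (∑ j ∈ range k, f j) ≠ 0 := pow_ne_zero _ hx.ne'
  have h2 : x ^ f k ≠ 0 := pow_ne_zero _ hx.ne'
  rcases neg_one_pow_eq_or ℝ k with h | h <;> rw [h] <;> field_simp <;> ring

/-- **weighted mass sum = weighted energy sum** (pure regrouping): if `μ 0 = e 0`, `μ (i+1) = e i + e (i+1)` (`i < n`) and `μ (n+1) = e n`, then
`Σ_{i ≤ n+1} d_i μ_i = Σ_{k ≤ n} (d_k + d_{k+1}) e_k`. [this file] -/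
theorem weighted_mass_sum (n : ℕ) (e μ : ℕ → ℝ) (c : ℕ → ℝ)
    (hμ0 : μ 0 = e 0) (hμ : ∀ i, i < n → μ (i + 1) = e i + e (i + 1)) (hμn : μ (n + 1) = e n) :
    ∑ i ∈ range (n + 2), c i * μ i = ∑ k ∈ range (n + 1), (c k + c (k + 1)) * e k := by
  induction n generalizing μ with
  | zero =>
    simp only [zero_add, sum_range_succ, sum_range_zero, hμ0]
    rw [show (0 : ℕ) + 1 = 1 from rfl] at hμn
    rw [hμn]; ring
  | succ n ih =>
    -- truncate the chain at `n`: masses `μ'` with `μ' (n+1) = e n`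
    have key := ih (fun i => if i = n + 1 then e n else μ i)
      (by show (if 0 = n + 1 then e n else μ 0) = e 0; rw [if_neg (by omega), hμ0])
      (fun i hi => by
        show (if i + 1 = n + 1 then e n else μ (i + 1)) = e i + e (i + 1)
        rw [if_neg (by omega)]; exact hμ i (by omega))
      (by show (if n + 1 = n + 1 then e n else μ (n + 1)) = e n; rw [if_pos rfl])
    rw [sum_range_succ] at key
    have hsame : ∑ i ∈ range (n + 1), c i * (if i = n + 1 then e n else μ i) = ∑ i ∈ range (n + 1), c i * μ i :=
      sum_congr rfl fun i hi => by rw [mem_range] at hi; rw [if_neg (by omega)]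
    rw [hsame, if_pos rfl] at key
    rw [show n + 1 + 2 = n + 1 + 1 + 1 from rfl, sum_range_succ, sum_range_succ, show n + 1 + 1 = n + 2 from rfl, hμn,
      hμ n (by omega), sum_range_succ (fun k => (c k + c (k + 1)) * e k) (n + 1)]
    linear_combination key

/-- **HELLMANN–FEYNMAN QUADRATIC FORM = −(slope-weighted energy).**  At a zero `x > 0` of `D_m` (`m = n + 2`), with `w_i = (−1)^i D_i / x^{F_i}`:
`Σ_{i<m} d_i x^{d_i} w_i² + 2·Σ_{k<m−1} f_k x^{f_k} w_k w_{k+1} = −Σ_{k<m−1} (2f_k − d_k − d_{k+1})·D_kD_{k+1}/x^{2F_k}` — the left side is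
`wᵀ(x·J'(x))w` for the entrywise derivative of the unit monomial matrix. [this file] -/
theorem quadForm_eq_neg_slopeEnergy (n : ℕ) (x : ℝ) (hx : 0 < x)
    (hroot : (pathDet (fun _ => (1 : ℝ)) d (fun _ => (1 : ℝ)) f (n + 2)).eval x = 0) :
    ∑ i ∈ range (n + 2), (d i : ℝ) * (x ^ d i *
        ((-1) ^ i * (pathDet (fun _ => (1 : ℝ)) d (fun _ => (1 : ℝ)) f i).eval x / x ^ (∑ j ∈ range i, f j)) ^ 2) +
      2 * ∑ k ∈ range (n + 1), (f k : ℝ) * (x ^ f k *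
        ((-1) ^ k * (pathDet (fun _ => (1 : ℝ)) d (fun _ => (1 : ℝ)) f k).eval x / x ^ (∑ j ∈ range k, f j)) *
        ((-1) ^ (k + 1) * (pathDet (fun _ => (1 : ℝ)) d (fun _ => (1 : ℝ)) f (k + 1)).eval x / x ^ (∑ j ∈ range (k + 1), f j))) =
      -∑ k ∈ range (n + 1), ((2 * (f k : ℝ)) - ((d k + d (k + 1) : ℕ) : ℝ)) *
        ((pathDet (fun _ => (1 : ℝ)) d (fun _ => (1 : ℝ)) f k).eval x * (pathDet (fun _ => (1 : ℝ)) d (fun _ => (1 : ℝ)) f (k + 1)).eval x /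
          x ^ (2 * ∑ j ∈ range k, f j)) := by
  obtain ⟨e, he⟩ : ∃ e : ℕ → ℝ, ∀ k, e k = (pathDet (fun _ => (1 : ℝ)) d (fun _ => (1 : ℝ)) f k).eval x *
      (pathDet (fun _ => (1 : ℝ)) d (fun _ => (1 : ℝ)) f (k + 1)).eval x / x ^ (2 * ∑ j ∈ range k, f j) := ⟨_, fun _ => rfl⟩
  obtain ⟨μ, hμ⟩ : ∃ μ : ℕ → ℝ, ∀ i, μ i = x ^ d i * (pathDet (fun _ => (1 : ℝ)) d (fun _ => (1 : ℝ)) f i).eval x ^ 2 /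
      x ^ (2 * ∑ j ∈ range i, f j) := ⟨_, fun _ => rfl⟩
  have hμe : ∀ i, μ (i + 1) = e i + e (i + 1) := by
    intro i; rw [hμ, he, he]; exact (energy_succ_add d f x hx i).symm
  have hμ0 : μ 0 = e 0 := by rw [hμ, he]; exact energy_zero d f x
  have heN : e (n + 1) = 0 := by rw [he, show n + 1 + 1 = n + 2 by omega, hroot, mul_zero, zero_div]
  have hμn : μ (n + 1) = e n := by rw [hμe, heN, add_zero]
  -- masses and links in terms of `μ`, `e`
  have hM : ∑ i ∈ range (n + 2), (d i : ℝ) * (x ^ d i *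
      ((-1) ^ i * (pathDet (fun _ => (1 : ℝ)) d (fun _ => (1 : ℝ)) f i).eval x / x ^ (∑ j ∈ range i, f j)) ^ 2) =
      ∑ i ∈ range (n + 2), (d i : ℝ) * μ i :=
    sum_congr rfl fun i _ => by rw [mass_eq, hμ]
  have hL : ∑ k ∈ range (n + 1), (f k : ℝ) * (x ^ f k *
      ((-1) ^ k * (pathDet (fun _ => (1 : ℝ)) d (fun _ => (1 : ℝ)) f k).eval x / x ^ (∑ j ∈ range k, f j)) *
      ((-1) ^ (k + 1) * (pathDet (fun _ => (1 : ℝ)) d (fun _ => (1 : ℝ)) f (k + 1)).eval x / x ^ (∑ j ∈ range (k + 1), f j))) =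
      ∑ k ∈ range (n + 1), (f k : ℝ) * (-e k) :=
    sum_congr rfl fun k _ => by rw [link_eq d f x hx, he]
  rw [hM, hL, weighted_mass_sum n e μ (fun i => (d i : ℝ)) hμ0 (fun i _ => hμe i) hμn, mul_sum, ← sum_add_distrib, ← sum_neg_distrib]
  refine sum_congr rfl fun k _ => ?_
  rw [he]; push_cast; ring

/-! ### 3. Small sizes: the separation hypothesis is automatic for `m ≤ 8` -/

/-- **CROSSING-DIRECTION LAW WITHOUT SEPARATION HYPOTHESIS, `m ≤ 8`**: at a nondegenerate zero of `D_m` (`3 ≤ m ≤ 8`) with every edge recessive at `x`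
the balance `Σ_k (d_k + d_{k+1} − 2f_k)·log x·D_kD_{k+1}x^{−2F_k}` is positive — for `m ≤ 8` the pattern «two negative pivot products three edges
apart» cannot occur at a zero (the first two and, by the zero, the last two pivot products are positive). [this file] -/
theorem slopeEnergy_balance_pos_of_le_eight (m : ℕ) (hm : 3 ≤ m) (hm8 : m ≤ 8) (x : ℝ) (hx : 0 < x)
    (hrec : ∀ k, k + 1 < m → x ^ (2 * f k) < x ^ (d k + d (k + 1)))
    (hroot : (pathDet (fun _ => (1 : ℝ)) d (fun _ => (1 : ℝ)) f m).eval x = 0)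
    (hnd : ∀ k, 0 < k → k < m → (pathDet (fun _ => (1 : ℝ)) d (fun _ => (1 : ℝ)) f k).eval x ≠ 0) :
    0 < ∑ k ∈ range (m - 1), (((d k + d (k + 1) : ℕ) : ℝ) - 2 * (f k : ℝ)) * log x *
      ((pathDet (fun _ => (1 : ℝ)) d (fun _ => (1 : ℝ)) f k).eval x * (pathDet (fun _ => (1 : ℝ)) d (fun _ => (1 : ℝ)) f (k + 1)).eval x /
        x ^ (2 * ∑ j ∈ range k, f j)) := by
  refine slopeEnergy_balance_pos d f m hm x hx hrec hroot hnd fun k hk hneg => ?_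
  obtain ⟨n, rfl⟩ : ∃ n, m = n + 2 := ⟨m - 2, by omega⟩
  -- the continuants near the two ends
  obtain ⟨e0, e1⟩ := eval_unit_zero_one d f x
  have e2 := eval_unit_add_two d f x 0
  simp only [zero_add] at e2
  have hDn1 : (pathDet (fun _ => (1 : ℝ)) d (fun _ => (1 : ℝ)) f (n + 1)).eval x ≠ 0 := hnd (n + 1) (by omega) (by omega)
  have hDn : (pathDet (fun _ => (1 : ℝ)) d (fun _ => (1 : ℝ)) f n).eval x ≠ 0 := hnd n (by omega) (by omega)
  have elast := eval_unit_add_two d f x n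
  rw [hroot] at elast
  -- (P1) the first two pivot products are positive
  have hP0 : 0 < (pathDet (fun _ => (1 : ℝ)) d (fun _ => (1 : ℝ)) f 0).eval x * (pathDet (fun _ => (1 : ℝ)) d (fun _ => (1 : ℝ)) f 1).eval x := by
    rw [e0, e1]; positivity
  have hP1 : 0 < (pathDet (fun _ => (1 : ℝ)) d (fun _ => (1 : ℝ)) f 1).eval x * (pathDet (fun _ => (1 : ℝ)) d (fun _ => (1 : ℝ)) f 2).eval x := by
    rw [e2, e1, e0, mul_one]
    have h0 := hrec 0 (by omega)
    simp only [zero_add] at h0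
    have : x ^ d 1 * x ^ d 0 = x ^ (d 0 + d 1) := by rw [← pow_add, add_comm]
    rw [this]
    exact mul_pos (pow_pos hx _) (by linarith)
  -- (P4) the last two pivot products are positive at the zero
  have hPn : 0 < (pathDet (fun _ => (1 : ℝ)) d (fun _ => (1 : ℝ)) f n).eval x * (pathDet (fun _ => (1 : ℝ)) d (fun _ => (1 : ℝ)) f (n + 1)).eval x := by
    -- `x^{d_{n+1}} D_{n+1} = x^{2f_n} D_n`
    have hsame : x ^ d (n + 1) * (pathDet (fun _ => (1 : ℝ)) d (fun _ => (1 : ℝ)) f (n + 1)).eval x =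
        x ^ (2 * f n) * (pathDet (fun _ => (1 : ℝ)) d (fun _ => (1 : ℝ)) f n).eval x := by linarith
    have hsq : 0 < (pathDet (fun _ => (1 : ℝ)) d (fun _ => (1 : ℝ)) f (n + 1)).eval x ^ 2 := by positivity
    have : x ^ (2 * f n) * ((pathDet (fun _ => (1 : ℝ)) d (fun _ => (1 : ℝ)) f n).eval x *
        (pathDet (fun _ => (1 : ℝ)) d (fun _ => (1 : ℝ)) f (n + 1)).eval x) =
        x ^ d (n + 1) * (pathDet (fun _ => (1 : ℝ)) d (fun _ => (1 : ℝ)) f (n + 1)).eval x ^ 2 := by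
      rw [pow_two, ← mul_assoc, ← hsame]; ring
    have hx2 : 0 < x ^ (2 * f n) := pow_pos hx _
    nlinarith [pow_pos hx (d (n + 1))]
  have hPn1 : 1 ≤ n → 0 < (pathDet (fun _ => (1 : ℝ)) d (fun _ => (1 : ℝ)) f (n - 1)).eval x *
      (pathDet (fun _ => (1 : ℝ)) d (fun _ => (1 : ℝ)) f n).eval x := by
    intro hn1
    obtain ⟨n', rfl⟩ : ∃ n', n = n' + 1 := ⟨n - 1, by omega⟩
    rw [Nat.add_sub_cancel]
    have eprev := eval_unit_add_two d f x n'
    -- recessive last edge: `x^{2f_{n'+1}} < x^{d_{n'+1} + d_{n'+2}}`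
    have hr := hrec (n' + 1) (by omega)
    rw [show n' + 1 + 1 = n' + 2 by omega] at hr
    -- from the zero: `x^{d_{n'+2}} D_{n'+2} = x^{2f_{n'+1}} D_{n'+1}`
    have hsame : x ^ d (n' + 2) * (pathDet (fun _ => (1 : ℝ)) d (fun _ => (1 : ℝ)) f (n' + 2)).eval x =
        x ^ (2 * f (n' + 1)) * (pathDet (fun _ => (1 : ℝ)) d (fun _ => (1 : ℝ)) f (n' + 1)).eval x := by
      rw [show n' + 1 + 1 = n' + 2 by omega] at elast; linarith
    -- hence `x^{2f_{n'}} D_{n'} D_{n'+1} = D_{n'+1}² · (x^{d_{n'+1}} − x^{2f_{n'+1}}/x^{d_{n'+2}}) > 0`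
    have hx1 : 0 < x ^ d (n' + 2) := pow_pos hx _
    have hx2 : 0 < x ^ (2 * f n') := pow_pos hx _
    have hsq : 0 < (pathDet (fun _ => (1 : ℝ)) d (fun _ => (1 : ℝ)) f (n' + 1)).eval x ^ 2 := by
      have := hnd (n' + 1) (by omega) (by omega); positivity
    have key : x ^ d (n' + 2) * (x ^ (2 * f n') * ((pathDet (fun _ => (1 : ℝ)) d (fun _ => (1 : ℝ)) f n').eval x *
        (pathDet (fun _ => (1 : ℝ)) d (fun _ => (1 : ℝ)) f (n' + 1)).eval x)) =
        (x ^ (d (n' + 1) + d (n' + 2)) - x ^ (2 * f (n' + 1))) * (pathDet (fun _ => (1 : ℝ)) d (fun _ => (1 : ℝ)) f (n' + 1)).eval x ^ 2 := by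
      have : x ^ (2 * f n') * (pathDet (fun _ => (1 : ℝ)) d (fun _ => (1 : ℝ)) f n').eval x =
          x ^ d (n' + 1) * (pathDet (fun _ => (1 : ℝ)) d (fun _ => (1 : ℝ)) f (n' + 1)).eval x -
            (pathDet (fun _ => (1 : ℝ)) d (fun _ => (1 : ℝ)) f (n' + 2)).eval x := by linarith
      rw [pow_add]
      linear_combination (x ^ d (n' + 2) * (pathDet (fun _ => (1 : ℝ)) d (fun _ => (1 : ℝ)) f (n' + 1)).eval x) * this -
        (pathDet (fun _ => (1 : ℝ)) d (fun _ => (1 : ℝ)) f (n' + 1)).eval x * hsame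
    have hpos : 0 < (x ^ (d (n' + 1) + d (n' + 2)) - x ^ (2 * f (n' + 1))) *
        (pathDet (fun _ => (1 : ℝ)) d (fun _ => (1 : ℝ)) f (n' + 1)).eval x ^ 2 := mul_pos (by linarith) hsq
    rw [← key] at hpos
    have h1 := (pos_iff_pos_of_mul_pos hpos).1 hx1
    exact (pos_iff_pos_of_mul_pos h1).1 hx2
  -- case analysis on `k ≤ 3`
  have hk3 : k ≤ 3 := by omega
  interval_cases k
  · exact absurd hneg (not_lt.2 hP0.le)
  · exact absurd hneg (not_lt.2 hP1.le)
  · -- k = 2 : m ∈ {7, 8}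
    rcases (show n = 5 ∨ n = 6 by omega) with rfl | rfl
    · exact hPn
    · exact hPn1 (by omega)
  · -- k = 3 : m = 8
    obtain rfl : n = 6 := by omega
    exact hPn
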